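import Literature.Combinatorics.Optimization.PatternMatrixPsdRank
import Literature.Computation.Certificates.SemidefiniteComplementarity
import HarnessLib

/-!
# Rescaling psd factorizations to bounded operator norm (Briët–Dadush–Pokutta, weak elementary form)

Briët–Dadush–Pokutta [cite: BrietDadushPokutta2014, Thm. 6 (§3, p. 7)]: "Let `Δ > 0`, `I, J` finite sets,
`M ∈ [0, Δ]^{I×J}` a nonnegative matrix with a rank-`r` semidefinite factorization `(U_i)_{i∈I}`,
`(V^j)_{j∈J}`, `M_{ij} = Tr(U_i V^j)`. Then there exists `A ⪰ 0` such that `(A U_i A)_i`, `(A⁺ V^j A⁺)_j` is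
a semidefinite factorization of `M` with `max_i ‖A U_i A‖ ≤ √(rΔ)` and `max_j ‖A⁺ V^j A⁺‖ ≤ √(rΔ)`."
The printed proof is a variational argument resting on John's ellipsoid theorem
[cite: BrietDadushPokutta2014, Thm. 5 (p. 6)]; restated (via John's theorem again) as Fawzi–Gouveia–Parrilo–
Robinson–Thomas [cite: FawziEtAl2015, Cor. 6.8 (§6.2)]: "If `M ∈ ℝ^{p×q}_+` has psd rank `k`, then there exist
`A_1, …, A_p, B_1, …, B_q ∈ S^k_+` such that `M_{ij} = ⟨A_i, B_j⟩` and the largest eigenvalue of `A_i` and `B_j`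
is bounded above by `√(k‖M‖_∞)`."

This file PROVES the following WEAKER, ELEMENTARY form (sandwiching factor `r` per side instead of John's
`√r`), which is all that hyperplane-separation lower bounds on psd rank consume up to a polynomial loss in `r`:

* `HasPsdFactorization.rescale_weak`: if `M ≤ Δ` entrywise (`0 < Δ`) has a psd factorization of size `r`,
  then `M i j = r² · Δ · Tr(X_i Y_j)` with `0 ⪯ X_i ⪯ I`, `0 ⪯ Y_j ⪯ I` (all `r × r`).
  [cite: BrietDadushPokutta2014, Thm. 6 (§3, p. 7)] — weak form, constants `(r, rΔ)` in place of `(√(rΔ), √(rΔ))`.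
* `HasPsdFactorization.weightedSum_le_of_psdRect` : the resulting HYPERPLANE-SEPARATION BOUND for psd rank —
  if every "psd rectangle" `(X, Y)` (`0 ⪯ X_i, Y_j ⪯ I`, `X_i Y_j = 0` wherever `M i j = 0`) has
  `Σ_{ij} W_{ij} Tr(X_i Y_j) ≤ r·γ`, then `⟨W, M⟩ ≤ r³·Δ·γ`; the `r = 1` case is Rothvoß's rectangle bound
  `xc(P) ≥ ⟨W,S⟩ / (‖S‖_∞ · max_R ⟨W,R⟩)` [cite: Rothvoss2017, §2 (PDF pp. 6–7)].

Proof of the weak rescaling (Auerbach-type extremal basis; no ellipsoids): adjoin the dummy factor `εI`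
(`ε = Δ/(1 + Σ_j Tr V_j)`, so all pairings stay `≤ Δ`) to make `K = {v : vᵀ U_i v ≤ 1 ∀ i}` compact; pick
rows `p_1, …, p_r ∈ K` maximising `|det|` (extreme value theorem); by Cramer's rule every `v ∈ K` has
coordinates in `[-1, 1]` w.r.t. the `p_k`, and by Cauchy–Schwarz for psd forms `Σ_k |c_k| ≤ 1 ⇒ Σ c_k p_k ∈ K`;
hence `P U_i Pᵀ ⪯ r·I` and, through the rank-one minorant `V ⪰ (Vc)(Vc)ᵀ/(cᵀVc)`, `P⁻ᵀ V_j P⁻¹ ⪯ rΔ·I`.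

NOT here: the `√(rΔ)` form (John's theorem is not in Mathlib); nonnegative-rank analogues.
-/

noncomputable section

open Matrix Finset
open scoped MatrixOrder

namespace Literature.Combinatorics.Optimization

open Literature.Computation.Certificates.SemidefiniteComplementarity

/-! ### Quadratic forms of real psd matrices: symmetry, Cauchy–Schwarz, absolutely convex combinations -/

section Forms

variable {d : Type*} [Fintype d]

omit [Fintype d] in
/-- A real Hermitian matrix equals its transpose. [folklore] -/
private theorem transpose_eq_of_isHermitian {A : Matrix d d ℝ} (hA : A.IsHermitian) : Aᵀ = A := by
  have h := hA.eq
  rwa [conjTranspose_eq_transpose_of_trivial] at h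

/-- Symmetry of the form `xᵀ A y` for real symmetric `A`. [folklore] -/
private theorem dotProduct_mulVec_symm {A : Matrix d d ℝ} (hA : A.IsHermitian) (x y : d → ℝ) :
    x ⬝ᵥ (A *ᵥ y) = y ⬝ᵥ (A *ᵥ x) := by
  rw [dotProduct_mulVec, ← mulVec_transpose, transpose_eq_of_isHermitian hA, dotProduct_comm]

/-- Nonnegativity of the form of a real psd matrix (no `star`). [folklore] -/
private theorem form_nonneg {A : Matrix d d ℝ} (hA : A.PosSemidef) (x : d → ℝ) :
    0 ≤ x ⬝ᵥ (A *ᵥ x) := by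
  simpa using hA.dotProduct_mulVec_nonneg x

/-- Cauchy–Schwarz for the form of a real psd matrix: `(xᵀAy)² ≤ (xᵀAx)(yᵀAy)`. [folklore] -/
private theorem dotProduct_mulVec_sq_le {A : Matrix d d ℝ} (hA : A.PosSemidef) (x y : d → ℝ) :
    (x ⬝ᵥ (A *ᵥ y)) ^ 2 ≤ (x ⬝ᵥ (A *ᵥ x)) * (y ⬝ᵥ (A *ᵥ y)) := by
  set a := y ⬝ᵥ (A *ᵥ y) with ha
  set b := x ⬝ᵥ (A *ᵥ y) with hb
  set c := x ⬝ᵥ (A *ᵥ x) with hc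
  have hquad : ∀ t : ℝ, 0 ≤ a * (t * t) + 2 * b * t + c := by
    intro t
    have h0 : 0 ≤ (x + t • y) ⬝ᵥ (A *ᵥ (x + t • y)) := form_nonneg hA _
    have hyx : y ⬝ᵥ (A *ᵥ x) = b := (dotProduct_mulVec_symm hA.1 y x).trans rfl
    have hexp : (x + t • y) ⬝ᵥ (A *ᵥ (x + t • y)) = a * (t * t) + 2 * b * t + c := by
      simp only [mulVec_add, mulVec_smul, dotProduct_add, add_dotProduct, dotProduct_smul,
        smul_dotProduct, smul_eq_mul, hyx, ← ha, ← hb, ← hc]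
      ring
    linarith [hexp ▸ h0]
  have hd := discrim_le_zero hquad
  unfold discrim at hd
  nlinarith [hd]

/-- Absolutely convex combinations of the "unit ball" of a psd form stay controlled:
`q(Σ_k c_k x_k) ≤ (Σ_k |c_k|)²` when `q(x_k) ≤ 1` for all `k`. [folklore] -/
private theorem form_sum_smul_le {A : Matrix d d ℝ} (hA : A.PosSemidef) {k : Type*} [Fintype k]
    (c : k → ℝ) (x : k → d → ℝ) (hx : ∀ a, x a ⬝ᵥ (A *ᵥ x a) ≤ 1) :
    (∑ a, c a • x a) ⬝ᵥ (A *ᵥ ∑ a, c a • x a) ≤ (∑ a, |c a|) ^ 2 := by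
  have hpair : ∀ a b, |x a ⬝ᵥ (A *ᵥ x b)| ≤ 1 := by
    intro a b
    have h1 := dotProduct_mulVec_sq_le hA (x a) (x b)
    have ha0 := form_nonneg hA (x a)
    have hb0 := form_nonneg hA (x b)
    have h2 : (x a ⬝ᵥ (A *ᵥ x b)) ^ 2 ≤ 1 := h1.trans (by nlinarith [hx a, hx b])
    exact (sq_le_one_iff_abs_le_one _).1 h2
  have key : ∀ a b, c a * (c b * (x b ⬝ᵥ (A *ᵥ x a))) ≤ |c a| * |c b| := by
    intro a b
    calc c a * (c b * (x b ⬝ᵥ (A *ᵥ x a))) ≤ |c a * (c b * (x b ⬝ᵥ (A *ᵥ x a)))| := le_abs_self _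
      _ = |c a| * (|c b| * |x b ⬝ᵥ (A *ᵥ x a)|) := by rw [abs_mul, abs_mul]
      _ ≤ |c a| * (|c b| * 1) := by gcongr; exact hpair b a
      _ = |c a| * |c b| := by ring
  have hL : (∑ a, c a • x a) ⬝ᵥ (A *ᵥ ∑ a, c a • x a) =
      ∑ a, ∑ b, c a * (c b * (x b ⬝ᵥ (A *ᵥ x a))) := by
    simp only [mulVec_sum, mulVec_smul, sum_dotProduct, dotProduct_sum, smul_dotProduct,
      dotProduct_smul, smul_eq_mul, mul_sum]
  rw [hL]
  calc ∑ a, ∑ b, c a * (c b * (x b ⬝ᵥ (A *ᵥ x a)))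
      ≤ ∑ a, ∑ b, |c a| * |c b| := sum_le_sum fun a _ => sum_le_sum fun b _ => key a b
    _ = (∑ a, |c a|) ^ 2 := by rw [sq, sum_mul_sum]

/-- Conjugated form: `cᵀ (P A Pᵀ) c = (cP) A (cP)ᵀ` with `c ᵥ* P = Σ_k c_k P_k`. [folklore] -/
private theorem form_conj (P A : Matrix d d ℝ) (c : d → ℝ) :
    c ⬝ᵥ ((P * A * Pᵀ) *ᵥ c) = (c ᵥ* P) ⬝ᵥ (A *ᵥ (c ᵥ* P)) := by
  rw [← mulVec_mulVec, ← mulVec_mulVec, dotProduct_mulVec, mulVec_transpose]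

/-- Rank-one lower bound in trace form: for psd `A`, `B` and any `c` with `s = cᵀBc`,
`(Bc)ᵀ A (Bc) ≤ s · Tr(A B)` (from `B ⪰ (Bc)(Bc)ᵀ/s`, a Cauchy–Schwarz consequence). [folklore] -/
private theorem form_mulVec_le_mul_trace [DecidableEq d] {A B : Matrix d d ℝ} (hA : A.PosSemidef)
    (hB : B.PosSemidef) (c : d → ℝ) :
    (B *ᵥ c) ⬝ᵥ (A *ᵥ (B *ᵥ c)) ≤ (c ⬝ᵥ (B *ᵥ c)) * (A * B).trace := by
  set w := B *ᵥ c with hw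
  set s := c ⬝ᵥ (B *ᵥ c) with hs
  have hs0 : 0 ≤ s := form_nonneg hB c
  rcases hs0.eq_or_lt with hs0 | hspos
  · -- `s = 0` forces `B c = 0`
    have hBc : B *ᵥ c = 0 := by
      have := (hB.dotProduct_mulVec_zero_iff c).1 (by simpa using hs0.symm)
      exact this
    have hw0 : w = 0 := by rw [hw, hBc]
    rw [hw0, ← hs0]
    simp
  · -- rank-one minorant `R = B - s⁻¹ • w wᵀ ⪰ 0`
    have hvv : (vecMulVec w w).IsHermitian := by
      rw [IsHermitian, conjTranspose_vecMulVec]; simp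
    have hR : (B - s⁻¹ • vecMulVec w w).PosSemidef := by
      refine PosSemidef.of_dotProduct_mulVec_nonneg (hB.1.sub (hvv.smul (IsSelfAdjoint.all _)))
        fun x => ?_
      have hcs : (x ⬝ᵥ w) ^ 2 ≤ (x ⬝ᵥ (B *ᵥ x)) * s := by
        rw [hw, hs]; exact dotProduct_mulVec_sq_le hB x c
      have hx : star x ⬝ᵥ ((B - s⁻¹ • vecMulVec w w) *ᵥ x) = x ⬝ᵥ (B *ᵥ x) - s⁻¹ * (x ⬝ᵥ w) ^ 2 := by
        simp only [star_trivial, sub_mulVec, smul_mulVec, vecMulVec_mulVec, dotProduct_sub,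
          dotProduct_smul, smul_eq_mul, MulOpposite.smul_eq_mul_unop, MulOpposite.unop_op]
        rw [dotProduct_comm w x]; ring_nf
      rw [hx, sub_nonneg, inv_mul_le_iff₀ hspos]
      linarith
    have h0 : 0 ≤ (A * (B - s⁻¹ • vecMulVec w w)).trace := frob_nonneg_of_posSemidef hA hR
    rw [Matrix.mul_sub, trace_sub, Matrix.mul_smul, trace_smul, mul_vecMulVec, trace_vecMulVec,
      smul_eq_mul, sub_nonneg, inv_mul_le_iff₀ hspos, dotProduct_comm] at h0
    exact h0

end Forms

/-! ### The Auerbach-type extremal basis for a finite family of psd forms -/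

section Auerbach

variable {ι : Type*} [Fintype ι] {d : ℕ}

/-- Determinant of `P` with row `k` replaced by `w ᵥ* P = Σ_m w_m P_m` is `w_k · det P`. [folklore] -/
private theorem det_updateRow_vecMul (P : Matrix (Fin d) (Fin d) ℝ) (w : Fin d → ℝ) (k : Fin d) :
    (P.updateRow k (w ᵥ* P)).det = w k * P.det := by
  rw [← cramer_transpose_apply, ← mulVec_transpose, cramer_eq_adjugate_mulVec, mulVec_mulVec,
    adjugate_mul, smul_mulVec, one_mulVec, det_transpose, Pi.smul_apply, smul_eq_mul, mul_comm]

/-- **Auerbach-type basis for a family of psd forms.** If `K = {v : vᵀ A_i v ≤ 1 ∀ i}` is bounded, there is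
an invertible `P` whose rows lie in `K` such that (i) `q_i(c ᵥ* P) ≤ (Σ|c_k|)²` for all `i, c`, and
(ii) `q_i(w ᵥ* P) ≤ l` for all `i` forces `‖w‖₂² ≤ d·l` (rows maximise `|det|` over `K^d`; Cramer).
[folklore] -/
private theorem exists_auerbach (A : ι → Matrix (Fin d) (Fin d) ℝ) (hA : ∀ i, (A i).PosSemidef)
    (R : ℝ) (hR : ∀ v : Fin d → ℝ, (∀ i, v ⬝ᵥ (A i *ᵥ v) ≤ 1) → ‖v‖ ≤ R) :
    ∃ P : Matrix (Fin d) (Fin d) ℝ, P.det ≠ 0 ∧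
      (∀ i (c : Fin d → ℝ), (c ᵥ* P) ⬝ᵥ (A i *ᵥ (c ᵥ* P)) ≤ (∑ k, |c k|) ^ 2) ∧
      (∀ (w : Fin d → ℝ) (l : ℝ), 0 < l → (∀ i, (w ᵥ* P) ⬝ᵥ (A i *ᵥ (w ᵥ* P)) ≤ l) →
        w ⬝ᵥ w ≤ d * l) := by
  classical
  -- the body `K` and the product set `S = K^d` (matrices with all rows in `K`)
  set K : Set (Fin d → ℝ) := {v | ∀ i, v ⬝ᵥ (A i *ᵥ v) ≤ 1} with hK
  have hKclosed : IsClosed K := by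
    rw [hK, Set.setOf_forall]
    refine isClosed_iInter fun i => isClosed_le ?_ continuous_const
    exact continuous_id.dotProduct (continuous_const.matrix_mulVec continuous_id)
  have hKbdd : Bornology.IsBounded K := isBounded_iff_forall_norm_le.2 ⟨R, fun v hv => hR v hv⟩
  have hKc : IsCompact K := Metric.isCompact_of_isClosed_isBounded hKclosed hKbdd
  set S : Set (Matrix (Fin d) (Fin d) ℝ) := Set.pi Set.univ fun _ => K with hS
  have hSc : IsCompact S := isCompact_univ_pi fun _ => hKc
  have hmemS : ∀ Q : Matrix (Fin d) (Fin d) ℝ, Q ∈ S ↔ ∀ k i, Q k ⬝ᵥ (A i *ᵥ Q k) ≤ 1 := by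
    intro Q
    change (∀ k, k ∈ Set.univ → Q k ∈ K) ↔ _
    simp only [Set.mem_univ, true_implies, hK, Set.mem_setOf_eq]
  have hSne : S.Nonempty :=
    ⟨0, (hmemS 0).2 fun k i => by
      rw [show (0 : Matrix (Fin d) (Fin d) ℝ) k = 0 from rfl, zero_dotProduct]; exact zero_le_one⟩
  have hcont : Continuous fun Q : Matrix (Fin d) (Fin d) ℝ => |Q.det| :=
    (continuous_id.matrix_det).abs
  obtain ⟨P, hPS, hPmax⟩ := hSc.exists_isMaxOn hSne hcont.continuousOn
  rw [isMaxOn_iff] at hPmax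
  have hProws : ∀ k i, P k ⬝ᵥ (A i *ᵥ P k) ≤ 1 := (hmemS P).1 hPS
  -- a witness in `S` with nonzero determinant: `s • 1` with `s = 1/(1 + Σ_i Σ_k (A i)_{kk})`
  have hdet : P.det ≠ 0 := by
    set T : ℝ := ∑ i, ∑ k, A i k k with hT
    have hT0 : 0 ≤ T := sum_nonneg fun i _ => sum_nonneg fun k _ => (hA i).diag_nonneg
    set s : ℝ := 1 / (1 + T) with hs
    have hs0 : 0 < s := by rw [hs]; positivity
    have hs1 : s ≤ 1 := by rw [hs, div_le_one (by positivity)]; linarith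
    have hQ : (s • (1 : Matrix (Fin d) (Fin d) ℝ)) ∈ S := by
      refine (hmemS _).2 fun k i => ?_
      have hdiag : A i k k ≤ T := by
        rw [hT]
        exact (single_le_sum (f := fun k => A i k k) (fun k _ => (hA i).diag_nonneg) (mem_univ k)).trans
          (single_le_sum (f := fun i => ∑ k, A i k k)
            (fun i _ => sum_nonneg fun k _ => (hA i).diag_nonneg) (mem_univ i))
      have hrow : (s • (1 : Matrix (Fin d) (Fin d) ℝ)) k = Pi.single k s := by
        ext j; simp [Matrix.one_apply, Pi.single_apply, eq_comm]
      rw [hrow]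
      simp only [single_dotProduct, mulVec, dotProduct_single]
      have hsT : s * (1 + T) = 1 := by rw [hs]; field_simp
      calc s * (A i k k * s) ≤ s * (T * s) := by gcongr
        _ ≤ s * ((1 + T) * s) := by gcongr; linarith
        _ = s * (s * (1 + T)) := by ring
        _ = s := by rw [hsT, mul_one]
        _ ≤ 1 := hs1
    have := hPmax _ hQ
    intro h0
    rw [h0, abs_zero, det_smul, det_one, mul_one, Fintype.card_fin] at this
    exact absurd this (not_le.2 (by positivity))
  refine ⟨P, hdet, fun i c => ?_, fun w l hl hw => ?_⟩
  · -- (i) absolutely convex combinations of the rows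
    rw [vecMul_eq_sum]
    exact form_sum_smul_le (hA i) c P (fun k => hProws k i)
  · -- (ii) Cramer: coordinates of `K` w.r.t. the rows of `P` lie in `[-1, 1]`
    set v := w ᵥ* P with hv
    set t : ℝ := (Real.sqrt l)⁻¹ with ht
    have ht0 : 0 < t := by rw [ht]; positivity
    have ht2 : t ^ 2 * l = 1 := by
      rw [ht, inv_pow, Real.sq_sqrt hl.le, inv_mul_cancel₀ hl.ne']
    have hk : ∀ k, w k ^ 2 ≤ l := by
      intro k
      have hmem : P.updateRow k (t • v) ∈ S := by
        refine (hmemS _).2 fun k' i => ?_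
        rcases eq_or_ne k' k with rfl | hne
        · rw [updateRow_self, mulVec_smul, dotProduct_smul, smul_dotProduct, smul_eq_mul, smul_eq_mul]
          have := hw i
          nlinarith [ht2, hw i, sq_nonneg t]
        · rw [updateRow_ne hne]; exact hProws k' i
      have hle := hPmax _ hmem
      rw [det_updateRow_smul, hv, det_updateRow_vecMul, abs_mul, abs_mul] at hle
      have hP0 : 0 < |P.det| := abs_pos.2 hdet
      have h1 : |t| * |w k| ≤ 1 := by
        by_contra hcon
        rw [not_le] at hcon
        have := mul_lt_mul_of_pos_right hcon hP0
        linarith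
      rw [abs_of_pos ht0] at h1
      have h2 : (t * |w k|) ^ 2 ≤ 1 := by
        have : 0 ≤ t * |w k| := by positivity
        calc (t * |w k|) ^ 2 ≤ 1 ^ 2 := by gcongr
          _ = 1 := one_pow 2
      nlinarith [sq_abs (w k), ht2, hl]
    calc w ⬝ᵥ w = ∑ k, w k ^ 2 := by simp [dotProduct, sq]
      _ ≤ ∑ _k : Fin d, l := sum_le_sum fun k _ => hk k
      _ = d * l := by simp

end Auerbach

/-! ### The weak rescaling theorem and the hyperplane-separation bound -/

section Rescale

variable {ι κ : Type*} [Fintype ι] [Fintype κ]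

omit [Fintype ι] [Fintype κ] in
/-- `0 ≤ c ⬝ᵥ c` over `ℝ`. [folklore] -/
private theorem dotProduct_self_nonneg' {d : Type*} [Fintype d] (c : d → ℝ) : 0 ≤ c ⬝ᵥ c :=
  sum_nonneg fun _ _ => mul_self_nonneg _

omit [Fintype ι] [Fintype κ] in
/-- Entries of a matrix with a psd factorization are nonnegative (`Tr(A B) ≥ 0` for psd `A, B`; psd
factorizations are factorizations of NONNEGATIVE matrices). [cite: FawziEtAl2015, §2 (Def. 2.2)] -/
theorem HasPsdFactorization.entry_nonneg {M : ι → κ → ℝ} {r : ℕ} (h : HasPsdFactorization M r)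
    (i : ι) (j : κ) : 0 ≤ M i j := by
  classical
  obtain ⟨A, B, hA, hB, hMAB⟩ := h
  rw [hMAB]
  exact frob_nonneg_of_posSemidef (hA i) (hB j)

/-- **Briët–Dadush–Pokutta rescaling of psd factorizations — weak elementary form.** If `M ≤ Δ` entrywise
(`0 < Δ`) has a psd factorization of size `r`, then `M_{ij} = r²·Δ·Tr(X_i Y_j)` with `0 ⪯ X_i ⪯ I` and
`0 ⪯ Y_j ⪯ I`, all of size `r`. The printed theorem has `√(rΔ)`-bounded factors on both sides (John's
ellipsoid theorem), i.e. `M = rΔ·Tr(X Y)`; this Auerbach-basis version loses one factor `r`.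
[cite: BrietDadushPokutta2014, Thm. 6 (§3, p. 7)] [cite: FawziEtAl2015, Cor. 6.8 (§6.2)] -/
theorem HasPsdFactorization.rescale_weak {M : ι → κ → ℝ} {r : ℕ} {Δ : ℝ} (hΔ : 0 < Δ)
    (hM : ∀ i j, M i j ≤ Δ) (h : HasPsdFactorization M r) :
    ∃ (X : ι → Matrix (Fin r) (Fin r) ℝ) (Y : κ → Matrix (Fin r) (Fin r) ℝ),
      (∀ i, (X i).PosSemidef ∧ (1 - X i).PosSemidef) ∧
      (∀ j, (Y j).PosSemidef ∧ (1 - Y j).PosSemidef) ∧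
      ∀ i j, M i j = (r : ℝ) ^ 2 * Δ * (X i * Y j).trace := by
  classical
  obtain ⟨A, B, hA, hB, hMAB⟩ := h
  rcases Nat.eq_zero_or_pos r with rfl | hr
  · refine ⟨fun _ => 0, fun _ => 0, fun i => ⟨PosSemidef.zero, by simpa using PosSemidef.one⟩,
      fun j => ⟨PosSemidef.zero, by simpa using PosSemidef.one⟩, fun i j => ?_⟩
    rw [hMAB]; simp [Matrix.trace]
  have hr' : (0 : ℝ) < r := by exact_mod_cast hr
  -- the dummy factor `ε • 1`, `ε = Δ / (1 + Σ_j Tr B_j)`, keeps all pairings `≤ Δ`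
  set T : ℝ := ∑ j, (B j).trace with hT
  have hT0 : 0 ≤ T := sum_nonneg fun j _ => (hB j).trace_nonneg
  set ε : ℝ := Δ / (1 + T) with hε
  have hε0 : 0 < ε := by rw [hε]; positivity
  set A' : Option ι → Matrix (Fin r) (Fin r) ℝ := fun o => o.elim (ε • 1) A with hA'def
  have hA' : ∀ o, (A' o).PosSemidef := by
    rintro (_ | i)
    · exact PosSemidef.one.smul hε0.le
    · exact hA i
  have hpair : ∀ o j, (A' o * B j).trace ≤ Δ := by
    rintro (_ | i) j
    · have hj : (B j).trace ≤ T :=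
        single_le_sum (f := fun j => (B j).trace) (fun j _ => (hB j).trace_nonneg) (mem_univ j)
      show (ε • (1 : Matrix (Fin r) (Fin r) ℝ) * B j).trace ≤ Δ
      rw [Matrix.smul_mul, Matrix.one_mul, trace_smul, smul_eq_mul]
      calc ε * (B j).trace ≤ ε * T := by gcongr
        _ = Δ * (T / (1 + T)) := by rw [hε]; ring
        _ ≤ Δ * 1 := by gcongr; rw [div_le_one (by positivity)]; linarith
        _ = Δ := mul_one Δ
    · show (A i * B j).trace ≤ Δ
      rw [← hMAB]; exact hM i j
  -- boundedness of the body through the dummy form `ε‖v‖²`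
  have hbd : ∀ v : Fin r → ℝ, (∀ o, v ⬝ᵥ (A' o *ᵥ v) ≤ 1) → ‖v‖ ≤ Real.sqrt (1 / ε) := by
    intro v hv
    have h0 : v ⬝ᵥ ((ε • (1 : Matrix (Fin r) (Fin r) ℝ)) *ᵥ v) ≤ 1 := hv none
    rw [smul_mulVec, one_mulVec, dotProduct_smul, smul_eq_mul] at h0
    have hvv : v ⬝ᵥ v ≤ 1 / ε := by
      rw [le_div_iff₀ hε0]; linarith [mul_comm ε (v ⬝ᵥ v)]
    rw [pi_norm_le_iff_of_nonneg (Real.sqrt_nonneg _)]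
    intro k
    rw [Real.norm_eq_abs, ← Real.sqrt_sq_eq_abs]
    apply Real.sqrt_le_sqrt
    calc v k ^ 2 ≤ ∑ k, v k ^ 2 :=
          single_le_sum (f := fun k => v k ^ 2) (fun k _ => sq_nonneg _) (mem_univ k)
      _ = v ⬝ᵥ v := by simp [dotProduct, sq]
      _ ≤ 1 / ε := hvv
  obtain ⟨P, hPdet, h1, h2⟩ := exists_auerbach A' hA' _ hbd
  have hPu : IsUnit P.det := isUnit_iff_ne_zero.2 hPdet
  have hPtu : IsUnit Pᵀ.det := by rwa [det_transpose]
  -- transformed factors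
  set At : Option ι → Matrix (Fin r) (Fin r) ℝ := fun o => P * A' o * Pᵀ with hAt
  set Bt : κ → Matrix (Fin r) (Fin r) ℝ := fun j => P⁻¹ᵀ * B j * P⁻¹ with hBt
  have hAt_psd : ∀ o, (At o).PosSemidef := fun o => by
    have := (hA' o).mul_mul_conjTranspose_same P
    rwa [conjTranspose_eq_transpose_of_trivial] at this
  have hBt_psd : ∀ j, (Bt j).PosSemidef := fun j => by
    have := (hB j).conjTranspose_mul_mul_same P⁻¹
    rwa [conjTranspose_eq_transpose_of_trivial] at this
  have htr : ∀ o j, (At o * Bt j).trace = (A' o * B j).trace := by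
    intro o j
    show (P * A' o * Pᵀ * (P⁻¹ᵀ * B j * P⁻¹)).trace = (A' o * B j).trace
    rw [transpose_nonsing_inv]
    calc (P * A' o * Pᵀ * (Pᵀ⁻¹ * B j * P⁻¹)).trace
        = (P * (A' o * (Pᵀ * (Pᵀ⁻¹ * (B j * P⁻¹))))).trace := by simp only [Matrix.mul_assoc]
      _ = (P * (A' o * (B j * P⁻¹))).trace := by rw [mul_nonsing_inv_cancel_left Pᵀ (B j * P⁻¹) hPtu]
      _ = (P * (A' o * B j) * P⁻¹).trace := by simp only [Matrix.mul_assoc]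
      _ = (P⁻¹ * P * (A' o * B j)).trace := trace_mul_cycle _ _ _
      _ = (A' o * B j).trace := by rw [nonsing_inv_mul _ hPu, Matrix.one_mul]
  have hformA : ∀ o c, c ⬝ᵥ (At o *ᵥ c) = (c ᵥ* P) ⬝ᵥ (A' o *ᵥ (c ᵥ* P)) :=
    fun o c => form_conj P (A' o) c
  -- (i) `At o ⪯ r • 1`
  have hAt_le : ∀ o c, c ⬝ᵥ (At o *ᵥ c) ≤ r * (c ⬝ᵥ c) := by
    intro o c
    rw [hformA]
    calc (c ᵥ* P) ⬝ᵥ (A' o *ᵥ (c ᵥ* P)) ≤ (∑ k, |c k|) ^ 2 := h1 o c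
      _ ≤ (#(univ : Finset (Fin r)) : ℝ) * ∑ k, |c k| ^ 2 := sq_sum_le_card_mul_sum_sq
      _ = r * (c ⬝ᵥ c) := by simp [dotProduct, sq]
  -- (ii) `Bt j ⪯ (r Δ) • 1`, through the rank-one minorant and (ii) of the Auerbach basis
  have hBt_le : ∀ j c, c ⬝ᵥ (Bt j *ᵥ c) ≤ r * Δ * (c ⬝ᵥ c) := by
    intro j c
    set w := Bt j *ᵥ c with hw
    have hs0 : 0 ≤ c ⬝ᵥ w := form_nonneg (hBt_psd j) c
    rcases hs0.eq_or_lt with hs00 | hspos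
    · rw [← hs00]; exact mul_nonneg (by positivity) (dotProduct_self_nonneg' c)
    · have hwo : ∀ o, (w ᵥ* P) ⬝ᵥ (A' o *ᵥ (w ᵥ* P)) ≤ (c ⬝ᵥ w) * Δ := by
        intro o
        rw [← hformA]
        calc w ⬝ᵥ (At o *ᵥ w) ≤ (c ⬝ᵥ w) * (At o * Bt j).trace :=
              form_mulVec_le_mul_trace (hAt_psd o) (hBt_psd j) c
          _ ≤ (c ⬝ᵥ w) * Δ := by
              rw [htr]; exact mul_le_mul_of_nonneg_left (hpair o j) hs0
      have hww : w ⬝ᵥ w ≤ r * ((c ⬝ᵥ w) * Δ) := h2 w _ (by positivity) hwo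
      have hcs : (c ⬝ᵥ w) ^ 2 ≤ (c ⬝ᵥ c) * (w ⬝ᵥ w) := by
        have := dotProduct_mulVec_sq_le (PosSemidef.one (n := Fin r) (R := ℝ)) c w
        simpa only [one_mulVec] using this
      have hkey : (c ⬝ᵥ w) * (c ⬝ᵥ w) ≤ (r * Δ * (c ⬝ᵥ c)) * (c ⬝ᵥ w) := by
        nlinarith [hww, hcs, dotProduct_self_nonneg' c]
      exact le_of_mul_le_mul_right hkey hspos
  -- assemble
  refine ⟨fun i => (r : ℝ)⁻¹ • At (some i), fun j => ((r : ℝ) * Δ)⁻¹ • Bt j,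
    fun i => ⟨(hAt_psd _).smul (by positivity), ?_⟩,
    fun j => ⟨(hBt_psd _).smul (by positivity), ?_⟩, fun i j => ?_⟩
  · refine PosSemidef.of_dotProduct_mulVec_nonneg
      (isHermitian_one.sub ((hAt_psd _).1.smul (IsSelfAdjoint.all _))) fun c => ?_
    rw [star_trivial, sub_mulVec, one_mulVec, smul_mulVec, dotProduct_sub, dotProduct_smul,
      smul_eq_mul, sub_nonneg, inv_mul_le_iff₀ hr']
    exact hAt_le _ c
  · refine PosSemidef.of_dotProduct_mulVec_nonneg
      (isHermitian_one.sub ((hBt_psd _).1.smul (IsSelfAdjoint.all _))) fun c => ?_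
    rw [star_trivial, sub_mulVec, one_mulVec, smul_mulVec, dotProduct_sub, dotProduct_smul,
      smul_eq_mul, sub_nonneg, inv_mul_le_iff₀ (by positivity)]
    exact hBt_le _ c
  · have hij : (A i * B j).trace = (At (some i) * Bt j).trace := (htr (some i) j).symm
    rw [hMAB, hij, Matrix.smul_mul, Matrix.mul_smul, trace_smul, trace_smul, smul_eq_mul, smul_eq_mul]
    field_simp

/-- **Hyperplane-separation lower bound for psd rank, weak form** (the `r`-dimensional analogue of
Rothvoß's rectangle bound `xc ≥ ⟨W,S⟩/(‖S‖_∞ · max_R ⟨W,R⟩)`, with the Briët–Dadush–Pokutta rescaling in its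
weak elementary form): if `M ≤ Δ` entrywise (`0 ≤ Δ`) has a psd factorization of size `r` and every PSD
RECTANGLE `(X, Y)` of dimension `r` — `0 ⪯ X_i ⪯ I`, `0 ⪯ Y_j ⪯ I`, `X_i Y_j = 0` wherever `M_{ij} = 0` — has
`Σ_{ij} W_{ij} Tr(X_i Y_j) ≤ r·γ`, then `⟨W, M⟩ ≤ r³·Δ·γ`.
[cite: Rothvoss2017, §2 (PDF pp. 6–7)] [cite: BrietDadushPokutta2014, Thm. 6 (§3, p. 7)] -/
theorem HasPsdFactorization.weightedSum_le_of_psdRect {M W : ι → κ → ℝ} {r : ℕ} {Δ γ : ℝ}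
    (hΔ : 0 ≤ Δ) (hM : ∀ i j, M i j ≤ Δ) (h : HasPsdFactorization M r)
    (hW : ∀ (X : ι → Matrix (Fin r) (Fin r) ℝ) (Y : κ → Matrix (Fin r) (Fin r) ℝ),
      (∀ i, (X i).PosSemidef ∧ (1 - X i).PosSemidef) →
      (∀ j, (Y j).PosSemidef ∧ (1 - Y j).PosSemidef) →
      (∀ i j, M i j = 0 → X i * Y j = 0) →
      ∑ i, ∑ j, W i j * (X i * Y j).trace ≤ r * γ) :
    ∑ i, ∑ j, W i j * M i j ≤ (r : ℝ) ^ 3 * Δ * γ := by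
  classical
  have hM0 : ∀ i j, 0 ≤ M i j := h.entry_nonneg
  rcases Nat.eq_zero_or_pos r with rfl | hr
  · -- `r = 0`: every entry is a `0 × 0` trace
    obtain ⟨A, B, -, -, hMAB⟩ := h
    have hM00 : ∀ i j, M i j = 0 := fun i j => by rw [hMAB]; simp [Matrix.trace]
    simp [hM00]
  have hr' : (0 : ℝ) < r := by exact_mod_cast hr
  -- `γ ≥ 0` from the zero rectangle
  have hγ : 0 ≤ γ := by
    have := hW (fun _ => 0) (fun _ => 0) (fun _ => ⟨PosSemidef.zero, by simpa using PosSemidef.one⟩)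
      (fun _ => ⟨PosSemidef.zero, by simpa using PosSemidef.one⟩) (fun _ _ _ => Matrix.zero_mul _)
    simp only [trace_zero, mul_zero, sum_const_zero] at this
    nlinarith
  rcases hΔ.eq_or_lt with hΔ0 | hΔpos
  · -- `Δ = 0`: `M = 0`
    have hM00 : ∀ i j, M i j = 0 := fun i j => le_antisymm (hΔ0 ▸ hM i j) (hM0 i j)
    simp [hM00, ← hΔ0]
  obtain ⟨X, Y, hX, hY, hMXY⟩ := h.rescale_weak hΔpos hM
  have hzero : ∀ i j, M i j = 0 → X i * Y j = 0 := by
    intro i j hij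
    rw [hMXY i j] at hij
    have htr : (X i * Y j).trace = 0 := by
      rcases mul_eq_zero.1 hij with h0 | h0
      · exact absurd h0 (by positivity)
      · exact h0
    exact (trace_mul_eq_zero_iff (hX i).1 (hY j).1).1 htr
  have hsum := hW X Y hX hY hzero
  calc ∑ i, ∑ j, W i j * M i j = (r : ℝ) ^ 2 * Δ * ∑ i, ∑ j, W i j * (X i * Y j).trace := by
        simp_rw [hMXY, mul_sum]
        exact sum_congr rfl fun i _ => sum_congr rfl fun j _ => by ring
    _ ≤ (r : ℝ) ^ 2 * Δ * (r * γ) := by gcongr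
    _ = (r : ℝ) ^ 3 * Δ * γ := by ring

end Rescale

end Literature.Combinatorics.Optimization

end
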